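/-
Copyright: lit-balaban Phase-2 proof seat p30 (gen 3).  Statement-level skeleton of a published paper; no proof claims beyond what
the kernel checks below.
-/
import Literature.MathematicalPhysics.QuantumFieldTheory.BalabanImbrieJaffe1984to88.BIJ85Prop521Proof
import Literature.MathematicalPhysics.QuantumFieldTheory.BalabanImbrieJaffe1984to88.BIJ85Eq531Inputs

/-!
# `BalabanImbrieJaffe1984to88.BIJ85Prop521Torus` — T. Bałaban, J. Imbrie, A. Jaffe, *Renormalization of the Higgs model: minimizers,
propagators and the stability of mean field theory*, Commun. Math. Phys. **97** (1985) 299–329 [BalabanImbrieJaffe1985]: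
**Proposition 5.2.1 (5.2.1)–(5.2.2) ON THE TORI of the series** — the model instance of `BIJ85Prop521Proof`

statement-level skeleton of published theorems with citation tags; proofs where landed; nothing here is a claim about the Yang–Mills mass gap

PDF held: `paper:balaban1985-cmp97-bij-higgs-minimizers` (journal page = PDF page + 298).  Page read as image: p. 316 [PDF 18]
(`run/shared/lean/pub/pub-balaban/t4/b2b-balaban-t4-lit2/renders/bij1985/1985-cmp97-bij-higgs-minimizers-p018-x2.png`).

CITATION HEADER (lean-in-tree rule).  Part of the lit-balaban TYPED SKELETON (HOME `run/shared/lean/pub/lit-balaban/`), Phase-2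
seat p30 (gen 3); row **C1.Prop5.2.1** of `HOME/SKELETON.md` (reader file `HOME/lit-balaban-r15/ROWS-C1.md`), companion of
`BIJ85Prop521Proof` (the operator identity (5.2.1) `G_{k,Ax} = H_{k−1,Ax}C^{(k−1)}H^*_{k−1,Ax} + G_{k−1,Ax}` PROVED in seat p09's
Euclidean framework under the printed factorisation of `δ(Q_kA)δ_{k,Ax}(A)` and no zero modes).  THE PRINTED TEXT, p. 316:
*"Write Q_k = QQ_{k−1}, and expand the integrand of (4.1.1) using δ(Q_kA)δ_{k,Ax}(A) = ∫𝒟Bδ(QB)δ(Q_{k−1}A − B)δ_{Ax}(B)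
δ_{k−1,Ax}(A)."*  WHAT IS DONE HERE, on the tori `T^{(j)}` of `…Balaban1983to89.Setup` with the encoding of
`BIJ85AxialPropagator411` (`BondSpace P`, `toE`, `curlOp w c`, `V411 P k` = the constraint subspace `δ(Q_kA)δ_{k,Ax}(A)` =
`constraint411 k`, `torusPropagator w c k` = `G_{k,Ax}`) and the composites of `BIJ85Eq531Inputs` (`Q^{s*}_j = QsstarIter j`,
`Q_jQ^{s*}_j = I`, `δ_{j,Ax}(Q^{s*}_jB)`, the translation onto `constraint411 j`):
* §1 the linear-map packaging: `Q^{s*}` and `Q^{s*}_j` are linear (`Qsstar_add/_smul`, `QsstarIter_add/_smul`), `Q_j` and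
  `Q^{s*}_j` as linear maps between the Euclidean spaces (`QcE`, `QsE`; coarse fields `CoarseSpace P j` = `ℓ²(PBond P j)`, `toEj`),
  and the unit-step constraint subspace `δ(QB)δ_{Ax}(B)` of level-j bond fields (`constraintStep j`, `Wstep P j`, `mem_Wstep`);
* §2 **THE PRINTED FACTORISATION, PROVED on the torus**: `A ∈ constraint411 (j+1) ⇔ (Q(Q_jA) = 0 ∧ δ_{Ax}(Q_jA)) ∧
  A − Q^{s*}_jQ_jA ∈ constraint411 j` (`factor_V411`; from `Q_{j+1} = QQ_j`, `δ_{j+1,Ax} = δ_{j,Ax}·δ_{Ax}(Q_j·)` (4.1.2) and the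
  translation lemmas of `BIJ85Eq531Inputs`), with `Q_jQ^{s*}_j = I` (`QcE_QsE`), `Q_j = 0` on `constraint411 j`
  (`QcE_eq_zero_of_mem`), `V411 P 0 = 0` (`V411_zero`), `V411 P j ≤ V411 P (j+1)` (`V411_mono`);
* §3 **(5.2.1) on the torus** (`eq521_torus`: `axialPropagator (V411 P (j+1)) ∂ = H_j C^{(j)} H_j^* + axialPropagator (V411 P j) ∂`
  with `H_j = HaxOp (V411 P j) ∂ Q^{s*}_j`, whose value at `B` is the torus minimizer `torusHax w c j (Q^{s*}_jB)` = `H_{j,Ax}B`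
  of (4.1.3)/(5.3.1) (`HaxOp_torus`), and `C^{(j)}` the propagator (4.3.3) of `‖∂H_{j,Ax}B‖²` on `δ(QB)δ_{Ax}(B)`); for the
  weighted torus propagator `G_{j+1,Ax} = G_{j,Ax} + η^d·ι⁻¹(H_jC^{(j)}H_j^*)ι` (`torusPropagator_succ`) and **(5.2.2)**
  `G_{k,Ax} = Σ_{j<k} η^d·ι⁻¹(H_jC^{(j)}H_j^*)ι` (`torusPropagator_eq_sum`).  Normalisation note: `H_j^*` and `C^{(j)}` are taken for
  the ℓ² pairing of `CoarseSpace P j`; the composite `H_jC^{(j)}H_j^*` does not depend on the normalisation of that pairing (a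
  weight λ multiplies `H_j^*` by λ and `C^{(j)}` by λ⁻¹), so it is the printed product for the pairing (2.14) of `T^{(j)}` as well.
Hypotheses: standing range `j ≤ m + K`, weight `w = η^d > 0`, and the p. 309 no-zero-modes claim at the top level (p09's form
`hD`; the lower levels follow, `BIJ85Prop521Proof.noZeroModes_sub`).
Unit `lit-balaban-p30` (literature-prover-lit-balaban-p30-g3-0), 2026-08-21.
-/

open scoped BigOperators RealInnerProductSpace

namespace Literature.MathematicalPhysics.QuantumFieldTheory.BalabanImbrieJaffe1984to88.BIJ85Prop521Torus

open Literature.MathematicalPhysics.QuantumFieldTheory.Balaban1983to89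
open BIJ85Sect2SurfaceAverages LatticeFieldCalculus BIJ85Eq219Proof BIJ85Eq531Inputs BIJ85AxialPropagator411
  BIJ85AxialMinimizer413 BIJ85Prop521Proof

variable {P : Params}

/-! ## 1. Linear-map packaging of `Q_j`, `Q^{s*}_j` and the unit-step constraint subspace -/

/-- kernel: the surface pull-back (2.17) is additive (any block geometry). [cite: BalabanImbrieJaffe1985, (2.17) p.304] -/
theorem Qsstar_add (G : BlockBonds) (B₁ B₂ : G.CB → ℝ) : G.Qsstar (B₁ + B₂) = G.Qsstar B₁ + G.Qsstar B₂ := by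
  funext b
  simp only [BlockBonds.Qsstar, Pi.add_apply, ← Finset.sum_add_distrib]
  refine Finset.sum_congr rfl fun c _ => ?_
  split_ifs <;> ring

/-- kernel: the surface pull-back (2.17) is homogeneous. [cite: BalabanImbrieJaffe1985, (2.17) p.304] -/
theorem Qsstar_smul (G : BlockBonds) (a : ℝ) (B : G.CB → ℝ) : G.Qsstar (a • B) = a • G.Qsstar B := by
  funext b
  simp only [BlockBonds.Qsstar, Pi.smul_apply, smul_eq_mul, Finset.mul_sum]
  refine Finset.sum_congr rfl fun c _ => ?_
  split_ifs <;> ring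

/-- kernel: `Q^{s*}_j` is additive. [cite: BalabanImbrieJaffe1985, (2.24) p.305] -/
theorem QsstarIter_add : ∀ (j : ℕ) (B₁ B₂ : PBond P j → ℝ),
    QsstarIter j (B₁ + B₂) = QsstarIter j B₁ + QsstarIter j B₂
  | 0, _, _ => rfl
  | j + 1, B₁, B₂ => by rw [QsstarIter_succ, QsstarIter_succ, QsstarIter_succ, Qsstar_add, QsstarIter_add j]

/-- kernel: `Q^{s*}_j` is homogeneous. [cite: BalabanImbrieJaffe1985, (2.24) p.305] -/
theorem QsstarIter_smul : ∀ (j : ℕ) (a : ℝ) (B : PBond P j → ℝ), QsstarIter j (a • B) = a • QsstarIter j B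
  | 0, _, _ => rfl
  | j + 1, a, B => by rw [QsstarIter_succ, QsstarIter_succ, Qsstar_smul, QsstarIter_smul j]

/-- `Q_j` (the iterated average `bondAvgIter j`) as a linear map. [cite: BalabanImbrieJaffe1985, (2.23) p.305] -/
noncomputable def bondAvgIterLin (j : ℕ) : VecField P 0 ℝ →ₗ[ℝ] VecField P j ℝ where
  toFun := bondAvgIter j
  map_add' := bondAvgIter_add j
  map_smul' a A := by rw [RingHom.id_apply]; exact bondAvgIter_smul j a A

/-- `Q^{s*}_j` as a linear map. [cite: BalabanImbrieJaffe1985, (2.24) p.305] -/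
noncomputable def QsstarIterLin (j : ℕ) : VecField P j ℝ →ₗ[ℝ] VecField P 0 ℝ where
  toFun := QsstarIter j
  map_add' := QsstarIter_add j
  map_smul' a B := by rw [RingHom.id_apply]; exact QsstarIter_smul j a B

/-- The bond fields of `T^{(j)}` as a Euclidean space (the `Ec` of `BIJ85Prop521Proof`). [folklore] -/
abbrev CoarseSpace (P : Params) (j : ℕ) : Type := EuclideanSpace ℝ (PBond P j)

/-- The identification of a level-j bond field with the vector of `CoarseSpace P j`. [folklore] -/
noncomputable def toEj (P : Params) (j : ℕ) : VecField P j ℝ ≃ₗ[ℝ] CoarseSpace P j :=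
  (WithLp.linearEquiv 2 ℝ (PBond P j → ℝ)).symm

/-- **`Q_j`** between the Euclidean spaces: `ι_j ∘ Q_j ∘ ι⁻¹`. [cite: BalabanImbrieJaffe1985, (2.23) p.305] -/
noncomputable def QcE (P : Params) (j : ℕ) : BondSpace P →ₗ[ℝ] CoarseSpace P j :=
  (toEj P j).toLinearMap ∘ₗ bondAvgIterLin j ∘ₗ (toE P).symm.toLinearMap

/-- **`Q^{s*}_j`** between the Euclidean spaces: `ι ∘ Q^{s*}_j ∘ ι_j⁻¹`. [cite: BalabanImbrieJaffe1985, (2.24) p.305] -/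
noncomputable def QsE (P : Params) (j : ℕ) : CoarseSpace P j →ₗ[ℝ] BondSpace P :=
  (toE P).toLinearMap ∘ₗ QsstarIterLin j ∘ₗ (toEj P j).symm.toLinearMap

/-- Unfolding `Q_j`. [cite: BalabanImbrieJaffe1985, (2.23) p.305] -/
theorem QcE_apply (j : ℕ) (A : BondSpace P) : QcE P j A = toEj P j (bondAvgIter j ((toE P).symm A)) := rfl

/-- Unfolding `Q^{s*}_j`. [cite: BalabanImbrieJaffe1985, (2.24) p.305] -/
theorem QsE_apply (j : ℕ) (B : CoarseSpace P j) : QsE P j B = toE P (QsstarIter j ((toEj P j).symm B)) := rfl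

/-- **The unit-step constraint subspace `δ(QB)δ_{Ax}(B)`** of the level-j bond fields (the domain of the `B` integral in (5.2.4),
(4.3.3)): `QB = 0` and the axial gauge. [cite: BalabanImbrieJaffe1985, (4.3.3) p.311] -/
def constraintStep (j : ℕ) : Submodule ℝ (VecField P j ℝ) where
  carrier := {B | bondAvg B = 0 ∧ IsAxial B}
  zero_mem' := ⟨bondAvg_zero, isAxial_zero⟩
  add_mem' := by
    rintro A B ⟨hA1, hA2⟩ ⟨hB1, hB2⟩
    exact ⟨by rw [bondAvg_add, hA1, hB1, add_zero], isAxial_add hA2 hB2⟩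
  smul_mem' := by
    rintro c A ⟨hA1, hA2⟩
    exact ⟨by rw [bondAvg_smul, hA1, smul_zero], isAxial_smul c hA2⟩

/-- Membership in `constraintStep`, unfolded. [cite: BalabanImbrieJaffe1985, (4.3.3) p.311] -/
theorem mem_constraintStep (j : ℕ) (B : VecField P j ℝ) :
    B ∈ (constraintStep j : Submodule ℝ (VecField P j ℝ)) ↔ bondAvg B = 0 ∧ IsAxial B := Iff.rfl

/-- `δ(QB)δ_{Ax}(B)` as a subspace of `CoarseSpace P j` (the `W` of `BIJ85Prop521Proof`). [cite: BalabanImbrieJaffe1985, (4.3.3) p.311] -/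
noncomputable def Wstep (P : Params) (j : ℕ) : Submodule ℝ (CoarseSpace P j) :=
  (constraintStep (P := P) j).map (toEj P j).toLinearMap

/-- Membership in `Wstep`: the underlying bond field satisfies `QB = 0` and `δ_{Ax}(B)`. [cite: BalabanImbrieJaffe1985, (4.3.3) p.311] -/
theorem mem_Wstep (j : ℕ) (B : CoarseSpace P j) :
    B ∈ Wstep P j ↔ bondAvg ((toEj P j).symm B) = 0 ∧ IsAxial ((toEj P j).symm B) := by
  unfold Wstep
  rw [Submodule.mem_map]
  constructor
  · rintro ⟨A, hA, rfl⟩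
    rw [LinearEquiv.coe_toLinearMap, LinearEquiv.symm_apply_apply]
    exact hA
  · intro h
    exact ⟨(toEj P j).symm B, h, by rw [LinearEquiv.coe_toLinearMap, LinearEquiv.apply_symm_apply]⟩

/-! ## 2. The printed factorisation of `δ(Q_{j+1}A)δ_{j+1,Ax}(A)` on the torus -/

/-- **`Q_jQ^{s*}_j = I`** for the Euclidean maps ((2.19)/(2.24), `BIJ85Eq531Inputs.bondAvgIter_QsstarIter`). [cite: BalabanImbrieJaffe1985, (2.19) p.305] -/
theorem QcE_QsE {j : ℕ} (hj : j ≤ P.m + P.K) (B : CoarseSpace P j) : QcE P j (QsE P j B) = B := by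
  rw [QcE_apply, QsE_apply, LinearEquiv.symm_apply_apply, bondAvgIter_QsstarIter hj, LinearEquiv.apply_symm_apply]

/-- `Q_j = 0` on the level-j constraint subspace `δ(Q_jA)δ_{j,Ax}(A)`. [cite: BalabanImbrieJaffe1985, (4.1.1) p.309] -/
theorem QcE_eq_zero_of_mem {j : ℕ} {v : BondSpace P} (hv : v ∈ V411 P j) : QcE P j v = 0 := by
  rw [QcE_apply, ((mem_V411 j v).1 hv).1, map_zero]

/-- `Q_{j+1} = QQ_j`. [cite: BalabanImbrieJaffe1985, (2.23) p.305] -/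
private theorem bondAvgIter_succ_apply (j : ℕ) (A : VecField P 0 ℝ) : bondAvgIter (j + 1) A = bondAvg (bondAvgIter j A) := rfl

/-- **The printed factorisation** *"δ(Q_kA)δ_{k,Ax}(A) = ∫𝒟Bδ(QB)δ(Q_{k−1}A − B)δ_{Ax}(B)δ_{k−1,Ax}(A)"* (k = j+1), PROVED on the
torus as the equivalence of constraint subspaces: `A ∈ δ(Q_{j+1}A)δ_{j+1,Ax}(A)` iff `B := Q_jA` satisfies `QB = 0`, `δ_{Ax}(B)`
and `A` lies in the class *"Q_{k−1}A = B and the appropriate axial gauge"*, i.e. `A − Q^{s*}_jB ∈ δ(Q_jA)δ_{j,Ax}(A)`.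
[cite: BalabanImbrieJaffe1985, Prop. 5.2.1 proof p.316] -/
theorem factor_V411 {j : ℕ} (hj : j ≤ P.m + P.K) (A : BondSpace P) :
    A ∈ V411 P (j + 1) ↔ QcE P j A ∈ Wstep P j ∧ A - QsE P j (QcE P j A) ∈ V411 P j := by
  set a : VecField P 0 ℝ := (toE P).symm A with ha
  have e2 : A - QsE P j (QcE P j A) = toE P (a - QsstarIter j (bondAvgIter j a)) := by
    rw [map_sub, LinearEquiv.apply_symm_apply, QsE_apply, QcE_apply, LinearEquiv.symm_apply_apply]
  rw [e2, mem_V411, mem_V411, QcE_apply, mem_Wstep, LinearEquiv.symm_apply_apply, LinearEquiv.symm_apply_apply, ← ha,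
    bondAvgIter_succ_apply, deltaAx_succ, ← mem_constraint411]
  constructor
  · rintro ⟨h1, h2, h3⟩
    exact ⟨⟨h1, h3⟩, sub_QsstarIter_mem_constraint411 hj rfl h2⟩
  · rintro ⟨⟨h1, h3⟩, hmem⟩
    have h := constraint411_add_QsstarIter hj hmem (bondAvgIter j a)
    rw [sub_add_cancel] at h
    exact ⟨h1, h.2, h3⟩

/-- `V411 P 0 = 0`: at level 0 the constraint `Q_0A = A = 0` (so `G_{0,Ax} = 0`, the empty sum of (5.2.2)). [cite: BalabanImbrieJaffe1985, (5.2.2) p.316] -/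
theorem V411_zero : V411 P 0 = ⊥ := by
  rw [eq_bot_iff]
  intro v hv
  have h : (toE P).symm v = 0 := ((mem_V411 0 v).1 hv).1
  rw [Submodule.mem_bot, ← (toE P).apply_symm_apply v, h, map_zero]

/-- The constraint subspaces increase with the level: `δ(Q_jA)δ_{j,Ax}(A) ⊆ δ(Q_{j+1}A)δ_{j+1,Ax}(A)`. [cite: BalabanImbrieJaffe1985, (4.1.2) p.309] -/
theorem V411_mono {j : ℕ} (hj : j ≤ P.m + P.K) : V411 P j ≤ V411 P (j + 1) :=
  le_of_factor (V := V411 P (j + 1)) (W := Wstep P j) (Qs := QsE P j) (fun v => QcE_eq_zero_of_mem v.2) (factor_V411 hj)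

/-! ## 3. (5.2.1) and (5.2.2) on the torus -/

/-- `H_j = HaxOp (V411 P j) ∂ Q^{s*}_j` IS the torus minimizer of (4.1.3)/(5.3.1): its value at `B` is `H_{j,Ax}B =
torusHax w c j (Q^{s*}_jB)` (no zero modes at level j). [cite: BalabanImbrieJaffe1985, (4.1.3) p.310] -/
theorem HaxOp_torus {j : ℕ} {w : ℝ} (c : ℝ) (hD : ∀ v : V411 P j, curlOp (P := P) w c (v : BondSpace P) = 0 → v = 0)
    (B : VecField P j ℝ) :
    (toE P).symm (HaxOp (V411 P j) (curlOp (P := P) w c) (QsE P j) (toEj P j B)) = torusHax w c j (QsstarIter j B) := by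
  rw [HaxOp_apply hD, QsE_apply, LinearEquiv.symm_apply_apply]
  rfl

/-- **(5.2.1) on the torus**: `G_{j+1,Ax} = H_{j,Ax}C^{(j)}H^*_{j,Ax} + G_{j,Ax}` for the Euclidean operators — `eq521` at the torus
data, the printed factorisation being `factor_V411`; no zero modes at level j+1 in the transported form. [cite: BalabanImbrieJaffe1985, Prop. 5.2.1 (5.2.1) p.316] -/
theorem eq521_torus' {j : ℕ} (hj : j ≤ P.m + P.K) {w : ℝ} (c : ℝ)
    (hD : ∀ v : V411 P (j + 1), curlOp (P := P) w c (v : BondSpace P) = 0 → v = 0) :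
    axialPropagator (V411 P (j + 1)) (curlOp (P := P) w c) =
      HaxOp (V411 P j) (curlOp (P := P) w c) (QsE P j)
        ∘ₗ axialPropagator (Wstep P j) (curlOp (P := P) w c ∘ₗ HaxOp (V411 P j) (curlOp (P := P) w c) (QsE P j))
        ∘ₗ LinearMap.adjoint (HaxOp (V411 P j) (curlOp (P := P) w c) (QsE P j))
      + axialPropagator (V411 P j) (curlOp (P := P) w c) :=
  eq521 hD (QcE_QsE hj) (fun v => QcE_eq_zero_of_mem v.2) (factor_V411 hj)

/-- **(5.2.1) on the torus**, with the no-zero-modes hypothesis in the form of seat p09's files (`w = η^d > 0`).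
[cite: BalabanImbrieJaffe1985, Prop. 5.2.1 (5.2.1) p.316] -/
theorem eq521_torus {j : ℕ} (hj : j ≤ P.m + P.K) {w : ℝ} (hw : 0 < w) (c : ℝ)
    (hD : ∀ A : VecField P 0 ℝ, A ∈ (constraint411 (j + 1) : Submodule ℝ (VecField P 0 ℝ)) →
      (∀ p, curl c A p = 0) → A = 0) :
    axialPropagator (V411 P (j + 1)) (curlOp (P := P) w c) =
      HaxOp (V411 P j) (curlOp (P := P) w c) (QsE P j)
        ∘ₗ axialPropagator (Wstep P j) (curlOp (P := P) w c ∘ₗ HaxOp (V411 P j) (curlOp (P := P) w c) (QsE P j))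
        ∘ₗ LinearMap.adjoint (HaxOp (V411 P j) (curlOp (P := P) w c) (QsE P j))
      + axialPropagator (V411 P j) (curlOp (P := P) w c) :=
  eq521_torus' hj c (noZeroModes_V411 hw c (j + 1) hD)

/-- **(5.2.1) for the weighted torus propagator** `G_{k,Ax} = torusPropagator w c k` (pairing `Σ_b η^d A_bJ_b`):
`G_{j+1,Ax} = G_{j,Ax} + η^d·ι⁻¹(H_jC^{(j)}H_j^*)ι`. [cite: BalabanImbrieJaffe1985, Prop. 5.2.1 (5.2.1) p.316] -/
theorem torusPropagator_succ {j : ℕ} (hj : j ≤ P.m + P.K) {w : ℝ} (c : ℝ)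
    (hD : ∀ v : V411 P (j + 1), curlOp (P := P) w c (v : BondSpace P) = 0 → v = 0) :
    torusPropagator w c (j + 1) = torusPropagator w c j
      + w • ((toE P).symm.toLinearMap
          ∘ₗ (HaxOp (V411 P j) (curlOp (P := P) w c) (QsE P j)
            ∘ₗ axialPropagator (Wstep P j) (curlOp (P := P) w c ∘ₗ HaxOp (V411 P j) (curlOp (P := P) w c) (QsE P j))
            ∘ₗ LinearMap.adjoint (HaxOp (V411 P j) (curlOp (P := P) w c) (QsE P j)))
          ∘ₗ (toE P).toLinearMap) := by
  unfold torusPropagator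
  rw [eq521_torus' hj c hD, LinearMap.add_comp, LinearMap.comp_add, smul_add, add_comm]

/-- **(5.2.2) for the weighted torus propagator**: `G_{k,Ax} = Σ_{j<k} η^d·ι⁻¹(H_jC^{(j)}H_j^*)ι` (no zero modes at the top
level k; `G_{0,Ax} = 0`). [cite: BalabanImbrieJaffe1985, Prop. 5.2.1 (5.2.2) p.316] -/
theorem torusPropagator_eq_sum {w : ℝ} (c : ℝ) :
    ∀ {k : ℕ}, k ≤ P.m + P.K → (∀ v : V411 P k, curlOp (P := P) w c (v : BondSpace P) = 0 → v = 0) →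
      torusPropagator w c k = ∑ j ∈ Finset.range k,
        w • ((toE P).symm.toLinearMap
          ∘ₗ (HaxOp (V411 P j) (curlOp (P := P) w c) (QsE P j)
            ∘ₗ axialPropagator (Wstep P j) (curlOp (P := P) w c ∘ₗ HaxOp (V411 P j) (curlOp (P := P) w c) (QsE P j))
            ∘ₗ LinearMap.adjoint (HaxOp (V411 P j) (curlOp (P := P) w c) (QsE P j)))
          ∘ₗ (toE P).toLinearMap)
  | 0, _, _ => by
    rw [Finset.sum_range_zero]
    unfold torusPropagator
    rw [V411_zero, axialPropagator_bot, LinearMap.zero_comp, LinearMap.comp_zero, smul_zero]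
  | k + 1, hk, hD => by
    have hk' : k ≤ P.m + P.K := by omega
    rw [Finset.sum_range_succ, ← torusPropagator_eq_sum c hk' (noZeroModes_sub (V411_mono hk') hD),
      torusPropagator_succ hk' c hD]

end Literature.MathematicalPhysics.QuantumFieldTheory.BalabanImbrieJaffe1984to88.BIJ85Prop521Torus

/-!
## v1.1 APPEND (seat p09 gen 2, lit-balaban; append-only to seat p30 gen 3's p247327 text above, which is unchanged)

statement-level skeleton of published theorems with citation tags; proofs where landed; nothing here is a claim about the Yang–Mills mass gap

The p09 two-scale hypotheses of `…BIJ85Prop521Proof` PART II (`hV′`, `hV`, `hQs`: the `(k−1)`-scale axial gauge `δ_{k−1,Ax}` as a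
subspace, `V = δ_{k−1,Ax} ∩ Q_{k−1}⁻¹(δ(QB)δ_{Ax}(B))`) discharged on the tori in p30's vocabulary (`CoarseSpace`, `toEj`, `QcE`, `QsE`,
`Wstep`), and what they buy beyond `eq521_torus`: **(5.2.1) on the torus for ANY operators satisfying the functional-integral definitions
(4.1.1)_{j+1}, (4.1.1)_j, (4.3.3)_j** (`prop521_form_torus`), **(4.3.3) on `T^{(j)}`** in the verbatim form `IsUnitPropagator` of
`…BIJ85UnitPropagator433` (`eq433_torus`), and the identification of the two `H_{j,Ax}` packagings on the torus (`Hop_torus`).  The p09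
proposal p247541 of a whole rival `BIJ85Prop521Torus.lean` BOUNCED (verified against the pre-union head) and is superseded by this append;
its duplicates of p30's `Qsstar_add/_smul`, `QsstarIter_add/_smul`, `bondAvgIterLin`, `QsstarIterLin`, `CoarseSpace`/`toEj`/`QcE`/`QsE`/`Wstep`
(there named `BondSpaceAt`/`toEAt`/`QmOp`/`QsOp`/`oneStep`) are NOT re-introduced.  Unit `lit-balaban-p09` (literature-prover-lit-balaban-p09-g2-0),
2026-08-21.
-/

namespace Literature.MathematicalPhysics.QuantumFieldTheory.BalabanImbrieJaffe1984to88.BIJ85Prop521Torus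

open Literature.MathematicalPhysics.QuantumFieldTheory.Balaban1983to89
open BIJ85Sect2SurfaceAverages LatticeFieldCalculus BIJ85Eq219Proof BIJ85Eq531Inputs BIJ85AxialPropagator411
  BIJ85AxialMinimizer413 BIJ85UnitPropagator433 BIJ85Prop521Proof
open scoped RealInnerProductSpace

variable {P : Params}

/-- **`δ_{j,Ax}`** — the `j`-scale axial gauge (4.1.2) `Π_{i<j}δ_{Ax}(Q_iA)` (`BIJ85AxialPropagator411.deltaAx j`) as a linear SUBSPACE of the
η-bond fields: the `δ_{k−1,Ax}(A)` factor of the printed decomposition `δ(Q_kA)δ_{k,Ax}(A) = ∫𝒟Bδ(QB)δ(Q_{k−1}A − B)δ_{Ax}(B)δ_{k−1,Ax}(A)`.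
[cite: BalabanImbrieJaffe1985, (4.1.2) p.309] -/
def axialSub (P : Params) (j : ℕ) : Submodule ℝ (BondSpace P) where
  carrier := {v | deltaAx j ((toE P).symm v)}
  zero_mem' := fun i _ => by rw [map_zero, bondAvgIter_map_zero]; exact isAxial_zero
  add_mem' := by
    intro v v' hv hv' i hi
    rw [map_add, bondAvgIter_add]
    exact isAxial_add (hv i hi) (hv' i hi)
  smul_mem' := by
    intro a v hv i hi
    rw [map_smul, bondAvgIter_smul]
    exact isAxial_smul a (hv i hi)

/-- Membership in `δ_{j,Ax}`, unfolded. [cite: BalabanImbrieJaffe1985, (4.1.2) p.309] -/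
theorem mem_axialSub (j : ℕ) (v : BondSpace P) : v ∈ axialSub P j ↔ deltaAx j ((toE P).symm v) := Iff.rfl

/-- `δ(Q_jA)δ_{j,Ax}(A) = δ_{j,Ax}(A)·[Q_jA = 0]`: `V411 P j` is the `V′` of `BIJ85Prop521Proof` PART II (`hV′`). [cite: BalabanImbrieJaffe1985, (5.2.3) p.316] -/
theorem mem_V411_iff_prev (j : ℕ) (A : BondSpace P) : A ∈ V411 P j ↔ A ∈ axialSub P j ∧ QcE P j A = 0 := by
  rw [mem_V411, mem_axialSub, QcE_apply, LinearEquiv.map_eq_zero_iff, and_comm]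

/-- **`δ(Q_kA)δ_{k,Ax}(A) = ∫𝒟Bδ(QB)δ(Q_{k−1}A − B)δ_{Ax}(B)δ_{k−1,Ax}(A)`** in the `hV` shape of `BIJ85Prop521Proof` PART II: `A ∈ V411 P (j+1)` iff
`δ_{j,Ax}(A)` and `Q_jA ∈ δ(QB)δ_{Ax}(B)` (*"Q_k = QQ_{k−1}"* = `bondAvgIter (j+1) = bondAvg ∘ bondAvgIter j`; (4.1.2) = `deltaAx_succ`); cf.
p30's `factor_V411` (the same decomposition phrased through the representative `Q^{s*}_jQ_jA`). [cite: BalabanImbrieJaffe1985, (5.2.3) p.316] -/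
theorem mem_V411_iff_next (j : ℕ) (A : BondSpace P) :
    A ∈ V411 P (j + 1) ↔ A ∈ axialSub P j ∧ QcE P j A ∈ Wstep P j := by
  rw [mem_V411, mem_axialSub, QcE_apply, mem_Wstep, LinearEquiv.symm_apply_apply, deltaAx_succ]
  constructor
  · rintro ⟨h1, h2, h3⟩; exact ⟨h2, h1, h3⟩
  · rintro ⟨h2, h1, h3⟩; exact ⟨h1, h2, h3⟩

/-- The representatives in the `hQs` shape of `BIJ85Prop521Proof` PART II: `δ_{j,Ax}(Q^{s*}_jB)` and `Q_jQ^{s*}_jB = B` (`BIJ85Eq531Inputs`,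
standing range `j ≤ m + K`). [cite: BalabanImbrieJaffe1985, (5.3.1) p.317] -/
theorem QsE_representative {j : ℕ} (hj : j ≤ P.m + P.K) (B : CoarseSpace P j) :
    QsE P j B ∈ axialSub P j ∧ QcE P j (QsE P j B) = B := by
  refine ⟨?_, QcE_QsE hj B⟩
  rw [mem_axialSub, QsE_apply, LinearEquiv.symm_apply_apply]
  exact deltaAx_QsstarIter hj _

/-- The two packagings of `H_{j,Ax}` agree on the torus and both ARE gen 1's Gaussian mean `torusHax` (4.1.3) at the representative
`Q^{s*}_jB` (no zero modes at level `j`, `w = η^d > 0`). [cite: BalabanImbrieJaffe1985, (4.1.3) p.310] -/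
theorem Hop_torus {w : ℝ} (hw : 0 < w) (c : ℝ) {j : ℕ}
    (hD : ∀ A : VecField P 0 ℝ, A ∈ (constraint411 j : Submodule ℝ (VecField P 0 ℝ)) → (∀ p, curl c A p = 0) → A = 0)
    (B : CoarseSpace P j) :
    Hop (V411 P j) (curlOp (P := P) w c) (QsE P j) B = toE P (torusHax w c j (QsstarIter j ((toEj P j).symm B))) := by
  rw [Hop_eq_HaxOp, ← HaxOp_torus c (noZeroModes_V411 hw c j hD) ((toEj P j).symm B), LinearEquiv.apply_symm_apply,
    LinearEquiv.apply_symm_apply]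

/-- **(5.2.1) on the torus at the level of the quadratic forms, for ANY operators** `G_{j+1,Ax}`, `G_{j,Ax}`, `C^{(j)}` satisfying the
functional-integral definitions (4.1.1) on `V411 P (j+1)`, `V411 P j` and (4.3.3) on `δ(QB)δ_{Ax}(B) = Wstep P j` (with the action Δ_j of
(4.3.1)–(4.3.2), `deltaOp`): for every source, `⟨J, G_{j+1,Ax}J⟩ = ⟨J, (H_{j,Ax}C^{(j)}H^*_{j,Ax} + G_{j,Ax})J⟩` — the printed route (5.2.3)–(5.2.5)
(`BIJ85Prop521Proof.prop521_form`) instantiated; `∂ = curlOp w c`, `w = η^d > 0`, the p. 309 no-zero-modes claim on the `(j+1)`-th domain as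
the hypothesis `hD`, standing range `j ≤ m + K`. [cite: BalabanImbrieJaffe1985, Prop. 5.2.1 (5.2.1) p.316] -/
theorem prop521_form_torus {w : ℝ} (hw : 0 < w) (c : ℝ) {j : ℕ} (hj : j ≤ P.m + P.K)
    (hD : ∀ A : VecField P 0 ℝ, A ∈ (constraint411 (j + 1) : Submodule ℝ (VecField P 0 ℝ)) → (∀ p, curl c A p = 0) → A = 0)
    {Gk G' : BondSpace P →ₗ[ℝ] BondSpace P} {C : CoarseSpace P j →ₗ[ℝ] CoarseSpace P j}
    (hGk : IsAxialPropagator (V411 P (j + 1)) (curlOp (P := P) w c) Gk) (hG' : IsAxialPropagator (V411 P j) (curlOp (P := P) w c) G')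
    (hC : IsUnitPropagator (Wstep P j) (deltaOp (V411 P j) (curlOp (P := P) w c) (QsE P j)) C) (J : BondSpace P) :
    ⟪J, Gk J⟫ = ⟪J, (Hop (V411 P j) (curlOp (P := P) w c) (QsE P j) ∘ₗ C ∘ₗ
      LinearMap.adjoint (Hop (V411 P j) (curlOp (P := P) w c) (QsE P j)) + G') J⟫ :=
  prop521_form (mem_V411_iff_prev j) (mem_V411_iff_next j) (QsE_representative hj) (noZeroModes_V411 hw c (j + 1) hD) hGk hG' hC J

/-- **(5.2.1) on the torus as an operator identity for symmetric such operators** (any symmetric `G_{j+1,Ax}`, `G_{j,Ax}`, `C^{(j)}` satisfying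
(4.1.1)_{j+1}, (4.1.1)_j, (4.3.3)_j): `G_{j+1,Ax} = H_{j,Ax}C^{(j)}H^*_{j,Ax} + G_{j,Ax}`. [cite: BalabanImbrieJaffe1985, Prop. 5.2.1 (5.2.1) p.316] -/
theorem prop521_of_symm_torus {w : ℝ} (hw : 0 < w) (c : ℝ) {j : ℕ} (hj : j ≤ P.m + P.K)
    (hD : ∀ A : VecField P 0 ℝ, A ∈ (constraint411 (j + 1) : Submodule ℝ (VecField P 0 ℝ)) → (∀ p, curl c A p = 0) → A = 0)
    {Gk G' : BondSpace P →ₗ[ℝ] BondSpace P} {C : CoarseSpace P j →ₗ[ℝ] CoarseSpace P j}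
    (hGk : IsAxialPropagator (V411 P (j + 1)) (curlOp (P := P) w c) Gk) (hG' : IsAxialPropagator (V411 P j) (curlOp (P := P) w c) G')
    (hC : IsUnitPropagator (Wstep P j) (deltaOp (V411 P j) (curlOp (P := P) w c) (QsE P j)) C)
    (hGks : ∀ x y, ⟪Gk x, y⟫ = ⟪x, Gk y⟫) (hG's : ∀ x y, ⟪G' x, y⟫ = ⟪x, G' y⟫) (hCs : ∀ x y, ⟪C x, y⟫ = ⟪x, C y⟫) :
    Gk = Hop (V411 P j) (curlOp (P := P) w c) (QsE P j) ∘ₗ C ∘ₗ LinearMap.adjoint (Hop (V411 P j) (curlOp (P := P) w c) (QsE P j)) + G' :=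
  prop521_of_symm (mem_V411_iff_prev j) (mem_V411_iff_next j) (QsE_representative hj) (noZeroModes_V411 hw c (j + 1) hD)
    hGk hG' hC hGks hG's hCs

/-- **(4.3.3) on `T^{(j)}`**: the operator formula `unitPropagator` (= p30's `axialPropagator (Wstep P j) (∂ ∘ HaxOp …)`, `unitPropagator_eq`)
satisfies the printed defining identity *"exp(½⟨J, C^{(k)}J⟩) = (Z^{(k)})^{−1}∫𝒟Bδ(QB)δ_{Ax}(B)exp(−½⟨B, Δ_kB⟩ + ⟨B, J⟩)"* over
`δ(QB)δ_{Ax}(B) = Wstep P j` with `Δ_j = (∂H_{j,Ax})^*(∂H_{j,Ax})`, and `Z^{(j)} > 0` — given no zero modes on the `(j+1)`-th domain.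
[cite: BalabanImbrieJaffe1985, (4.3.3) p.311] -/
theorem eq433_torus {w : ℝ} (hw : 0 < w) (c : ℝ) {j : ℕ} (hj : j ≤ P.m + P.K)
    (hD : ∀ A : VecField P 0 ℝ, A ∈ (constraint411 (j + 1) : Submodule ℝ (VecField P 0 ℝ)) → (∀ p, curl c A p = 0) → A = 0) :
    IsUnitPropagator (Wstep P j) (deltaOp (V411 P j) (curlOp (P := P) w c) (QsE P j))
        (unitPropagator (V411 P j) (curlOp (P := P) w c) (QsE P j) (Wstep P j)) ∧
      0 < unitZ (Wstep P j) (deltaOp (V411 P j) (curlOp (P := P) w c) (QsE P j)) :=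
  isUnitPropagator_unitPropagator _ _ _ _
    (noZeroModes_W (mem_V411_iff_prev j) (mem_V411_iff_next j) (QsE_representative hj) (noZeroModes_V411 hw c (j + 1) hD))

end Literature.MathematicalPhysics.QuantumFieldTheory.BalabanImbrieJaffe1984to88.BIJ85Prop521Torus
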